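import Mathlib
import HarnessLib
import Summits.MatrixMultiplication.MatrixMultiplication.Theorems.FarEdgeDescentBoxVertex
import Summits.MatrixMultiplication.MatrixMultiplication.Theorems.FarEdgeDescentTreeCapEnvTools

/-!
# Far-edge descent, kernel XLII-H — certificate tools: the cell claim of the region criterion from 32 closed
# rational checks (model level, generic real analysis)

The Lean side of the certificate blueprint (memo g62 §2.5 / §5.1, cert3.py).  A CELL is a box
`[l₀,l₁]×[V₀,V₁]×[m₀,m₁]×[W₀,W₁]` in `(λ, V, λ', V')` together with an x-interval `[x₁,x₂]`; `CellClaim` says the pair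
inequality of `RegionCriterion β z ε Vmin κ` holds for every region point of the box and every `x ∈ [x₁,x₂]`, and
`BoxClaim` is the case `[x₁,x₂] = [0,1]`.  THIS FILE proves:
* `leafCell` — a `CellClaim` from DATA: tangent majorants of `x^κ`, `(1−x)^κ` at the right endpoints `x₂`, `1−x₁`
  with the exponent replaced by `17/41 ≤ κ` (`tangent_right`; so every coefficient is rational) and certified heights
  `x₂^κ ≤ ρ`, `(1−x₁)^κ ≤ σ`; the two endpoint inequalities each follow from SIXTEEN vertex values of
  `cellExprM = cellExpr − Σ μᵢ·Gᵢ` (`cellM`; XLII-G `box4`), where `G₁ … G₇ ≥ 0` are the region constraints valid on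
  the box — product floor, the pins `|1−(2β−1)λ| ≤ V²` relaxed by the chord `V² ≤ (V₀+V₁)V − V₀V₁`, the wedges — and
  `μᵢ ≥ 0` are multipliers (S-procedure);
* the combinators `xsplit`, `box_of_cell`, `split_l`, `split_V`, `split_m`, `split_W` (bisection) and
  `regionCriterion_of_boxClaim` (the root box gives `RegionCriterion`).
A certificate is then a list of one-line theorems (cert3.py emits them).  No `sorry`, no new axioms.
-/

noncomputable section

set_option linter.dupNamespace false

namespace Summit.MatrixMultiplication.MatrixMultiplication.Theorems.FarEdgeDescentCertTools

open Summit.MatrixMultiplication.MatrixMultiplication.Theorems.FarEdgeDescentBoxVertex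
open Summit.MatrixMultiplication.MatrixMultiplication.Theorems.FarEdgeDescentNarrownessPotential

/-! ## Claims -/

/-- The pair inequality of the region criterion on the cell `box × [x₁, x₂]`, for every region point of the box. -/
def CellClaim (β z ε Vmin κ l₀ l₁ V₀ V₁ m₀ m₁ W₀ W₁ x₁ x₂ : ℝ) : Prop :=
  ∀ lam lam' V V' VP x : ℝ,
    l₀ ≤ lam → lam ≤ l₁ → V₀ ≤ V → V ≤ V₁ → m₀ ≤ lam' → lam' ≤ m₁ → W₀ ≤ V' → V' ≤ W₁ →
    0 ≤ lam → β * lam ≤ 1 → 0 ≤ lam' → β * lam' ≤ 1 → 0 ≤ V → V ≤ 1 → 0 ≤ V' → V' ≤ 1 →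
    β * ((2 * β - 1) * lam - 1) ≤ (β - 1) * V → β * ((2 * β - 1) * lam' - 1) ≤ (β - 1) * V' →
    |1 - (2 * β - 1) * lam| ≤ V ^ 2 → |1 - (2 * β - 1) * lam'| ≤ V' ^ 2 →
    VP * (lam + lam' - (2 * β - 1) * lam * lam') =
      lam' * (1 - β * lam) * V' + lam * (1 - β * lam') * V + z * lam * lam' * V * V' →
    Vmin ≤ VP → x₁ ≤ x → x ≤ x₂ → 0 ≤ x → x ≤ 1 →
      (1 - (β - 1) * lam') * (lam * (ε + 1 - V)) * x ^ κ +
          (1 - (β - 1) * lam) * (lam' * (ε + 1 - V')) * (1 - x) ^ κ ≤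
        (lam + lam' - (2 * β - 1) * lam * lam') * (ε + 1 - VP)

/-- The pair inequality on the box for all `x ∈ [0, 1]`. -/
def BoxClaim (β z ε Vmin κ l₀ l₁ V₀ V₁ m₀ m₁ W₀ W₁ : ℝ) : Prop :=
  CellClaim β z ε Vmin κ l₀ l₁ V₀ V₁ m₀ m₁ W₀ W₁ 0 1

/-! ## Combinators -/

/-- Glue two x-cells. -/
theorem xsplit {β z ε Vmin κ l₀ l₁ V₀ V₁ m₀ m₁ W₀ W₁ x₁ xm x₂ : ℝ}
    (h1 : CellClaim β z ε Vmin κ l₀ l₁ V₀ V₁ m₀ m₁ W₀ W₁ x₁ xm)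
    (h2 : CellClaim β z ε Vmin κ l₀ l₁ V₀ V₁ m₀ m₁ W₀ W₁ xm x₂) :
    CellClaim β z ε Vmin κ l₀ l₁ V₀ V₁ m₀ m₁ W₀ W₁ x₁ x₂ := by
  intro lam lam' V V' VP x a1 a2 a3 a4 a5 a6 a7 a8 b1 b2 b3 b4 b5 b6 b7 b8 c1 c2 c3 c4 hP hVP hx1 hx2 hx0 hx1'
  rcases le_total x xm with h | h
  · exact h1 lam lam' V V' VP x a1 a2 a3 a4 a5 a6 a7 a8 b1 b2 b3 b4 b5 b6 b7 b8 c1 c2 c3 c4 hP hVP hx1 h hx0 hx1'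
  · exact h2 lam lam' V V' VP x a1 a2 a3 a4 a5 a6 a7 a8 b1 b2 b3 b4 b5 b6 b7 b8 c1 c2 c3 c4 hP hVP h hx2 hx0 hx1'

/-- A box claim is the cell claim on `[0, 1]`. -/
theorem box_of_cell {β z ε Vmin κ l₀ l₁ V₀ V₁ m₀ m₁ W₀ W₁ : ℝ}
    (h : CellClaim β z ε Vmin κ l₀ l₁ V₀ V₁ m₀ m₁ W₀ W₁ 0 1) :
    BoxClaim β z ε Vmin κ l₀ l₁ V₀ V₁ m₀ m₁ W₀ W₁ := h

/-- Bisection in `λ`. -/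
theorem split_l {β z ε Vmin κ l₀ lm l₁ V₀ V₁ m₀ m₁ W₀ W₁ : ℝ}
    (h1 : BoxClaim β z ε Vmin κ l₀ lm V₀ V₁ m₀ m₁ W₀ W₁) (h2 : BoxClaim β z ε Vmin κ lm l₁ V₀ V₁ m₀ m₁ W₀ W₁) :
    BoxClaim β z ε Vmin κ l₀ l₁ V₀ V₁ m₀ m₁ W₀ W₁ := by
  intro lam lam' V V' VP x a1 a2 a3 a4 a5 a6 a7 a8 b1 b2 b3 b4 b5 b6 b7 b8 c1 c2 c3 c4 hP hVP hx1 hx2 hx0 hx1'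
  rcases le_total lam lm with h | h
  · exact h1 lam lam' V V' VP x a1 h a3 a4 a5 a6 a7 a8 b1 b2 b3 b4 b5 b6 b7 b8 c1 c2 c3 c4 hP hVP hx1 hx2 hx0 hx1'
  · exact h2 lam lam' V V' VP x h a2 a3 a4 a5 a6 a7 a8 b1 b2 b3 b4 b5 b6 b7 b8 c1 c2 c3 c4 hP hVP hx1 hx2 hx0 hx1'

/-- Bisection in `V`. -/
theorem split_V {β z ε Vmin κ l₀ l₁ V₀ Vm V₁ m₀ m₁ W₀ W₁ : ℝ}
    (h1 : BoxClaim β z ε Vmin κ l₀ l₁ V₀ Vm m₀ m₁ W₀ W₁) (h2 : BoxClaim β z ε Vmin κ l₀ l₁ Vm V₁ m₀ m₁ W₀ W₁) :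
    BoxClaim β z ε Vmin κ l₀ l₁ V₀ V₁ m₀ m₁ W₀ W₁ := by
  intro lam lam' V V' VP x a1 a2 a3 a4 a5 a6 a7 a8 b1 b2 b3 b4 b5 b6 b7 b8 c1 c2 c3 c4 hP hVP hx1 hx2 hx0 hx1'
  rcases le_total V Vm with h | h
  · exact h1 lam lam' V V' VP x a1 a2 a3 h a5 a6 a7 a8 b1 b2 b3 b4 b5 b6 b7 b8 c1 c2 c3 c4 hP hVP hx1 hx2 hx0 hx1'
  · exact h2 lam lam' V V' VP x a1 a2 h a4 a5 a6 a7 a8 b1 b2 b3 b4 b5 b6 b7 b8 c1 c2 c3 c4 hP hVP hx1 hx2 hx0 hx1'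

/-- Bisection in `λ'`. -/
theorem split_m {β z ε Vmin κ l₀ l₁ V₀ V₁ m₀ mm m₁ W₀ W₁ : ℝ}
    (h1 : BoxClaim β z ε Vmin κ l₀ l₁ V₀ V₁ m₀ mm W₀ W₁) (h2 : BoxClaim β z ε Vmin κ l₀ l₁ V₀ V₁ mm m₁ W₀ W₁) :
    BoxClaim β z ε Vmin κ l₀ l₁ V₀ V₁ m₀ m₁ W₀ W₁ := by
  intro lam lam' V V' VP x a1 a2 a3 a4 a5 a6 a7 a8 b1 b2 b3 b4 b5 b6 b7 b8 c1 c2 c3 c4 hP hVP hx1 hx2 hx0 hx1'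
  rcases le_total lam' mm with h | h
  · exact h1 lam lam' V V' VP x a1 a2 a3 a4 a5 h a7 a8 b1 b2 b3 b4 b5 b6 b7 b8 c1 c2 c3 c4 hP hVP hx1 hx2 hx0 hx1'
  · exact h2 lam lam' V V' VP x a1 a2 a3 a4 h a6 a7 a8 b1 b2 b3 b4 b5 b6 b7 b8 c1 c2 c3 c4 hP hVP hx1 hx2 hx0 hx1'

/-- Bisection in `V'`. -/
theorem split_W {β z ε Vmin κ l₀ l₁ V₀ V₁ m₀ m₁ W₀ Wm W₁ : ℝ}
    (h1 : BoxClaim β z ε Vmin κ l₀ l₁ V₀ V₁ m₀ m₁ W₀ Wm) (h2 : BoxClaim β z ε Vmin κ l₀ l₁ V₀ V₁ m₀ m₁ Wm W₁) :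
    BoxClaim β z ε Vmin κ l₀ l₁ V₀ V₁ m₀ m₁ W₀ W₁ := by
  intro lam lam' V V' VP x a1 a2 a3 a4 a5 a6 a7 a8 b1 b2 b3 b4 b5 b6 b7 b8 c1 c2 c3 c4 hP hVP hx1 hx2 hx0 hx1'
  rcases le_total V' Wm with h | h
  · exact h1 lam lam' V V' VP x a1 a2 a3 a4 a5 a6 a7 h b1 b2 b3 b4 b5 b6 b7 b8 c1 c2 c3 c4 hP hVP hx1 hx2 hx0 hx1'
  · exact h2 lam lam' V V' VP x a1 a2 a3 a4 a5 a6 h a8 b1 b2 b3 b4 b5 b6 b7 b8 c1 c2 c3 c4 hP hVP hx1 hx2 hx0 hx1'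

/-- The root box `[0, 1/β] × [Vmin, 1] × [0, 1/β] × [Vmin, 1]` gives the region criterion (`0 < β`, `0 ≤ Vmin`). -/
theorem regionCriterion_of_boxClaim {β z ε Vmin κ L : ℝ} (hβ : 0 < β) (hL : 1 / β ≤ L) (hV : 0 ≤ Vmin)
    (h : BoxClaim β z ε Vmin κ 0 L Vmin 1 0 L Vmin 1) : RegionCriterion β z ε Vmin κ := by
  intro lam lam' V V' VP hl hl1 hl' hl1' hVm hV1 hVm' hV1' hW hW' hQ hQ' hP hVP x hx0 hx1
  have hlL : lam ≤ L := by
    have : lam ≤ 1 / β := by rw [le_div_iff₀ hβ]; linarith [mul_comm β lam]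
    exact this.trans hL
  have hlL' : lam' ≤ L := by
    have : lam' ≤ 1 / β := by rw [le_div_iff₀ hβ]; linarith [mul_comm β lam']
    exact this.trans hL
  exact h lam lam' V V' VP x hl.le hlL hVm hV1 hl'.le hlL' hVm' hV1' hl.le hl1 hl'.le hl1' (hV.trans hVm) hV1
    (hV.trans hVm') hV1' hW hW' hQ hQ' hP hVP hx0 hx1 hx0 hx1

/-! ## Region constraints valid on a box -/

/-- Product-floor constraint `G₁ = numerator − Vmin·Λ_P`. -/
def gP (β z Vmin l lp V W : ℝ) : ℝ :=
  lp * (1 - β * l) * W + l * (1 - β * lp) * V + z * l * lp * V * W - Vmin * (l + lp - (2 * β - 1) * l * lp)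

/-- Pin constraint (lower sign) relaxed by the chord of `V²` on `[V₀, V₁]`: `(V₀+V₁)V − V₀V₁ − (1 − (2β−1)l)`. -/
def gQm (β V₀ V₁ l V : ℝ) : ℝ := (V₀ + V₁) * V - V₀ * V₁ - (1 - (2 * β - 1) * l)

/-- Pin constraint (upper sign), chord-relaxed: `(V₀+V₁)V − V₀V₁ − ((2β−1)l − 1)`. -/
def gQp (β V₀ V₁ l V : ℝ) : ℝ := (V₀ + V₁) * V - V₀ * V₁ - ((2 * β - 1) * l - 1)

/-- Wedge constraint `(β−1)V − β((2β−1)l − 1)`. -/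
def gW (β l V : ℝ) : ℝ := (β - 1) * V - β * ((2 * β - 1) * l - 1)

/-- `Λ_P = λ + λ' − (2β−1)λλ' ≥ λλ' ≥ 0` on `0 ≤ λ, λ' ≤ 1/β`. -/
theorem lamP_nonneg {β l lp : ℝ} (hl0 : 0 ≤ l) (hl1 : β * l ≤ 1) (hm0 : 0 ≤ lp) (hm1 : β * lp ≤ 1) :
    0 ≤ l + lp - (2 * β - 1) * l * lp := by
  have h1 : β * l * lp ≤ 1 * lp := mul_le_mul_of_nonneg_right hl1 hm0
  have h2 : β * lp * l ≤ 1 * l := mul_le_mul_of_nonneg_right hm1 hl0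
  have h3 : 0 ≤ l * lp := mul_nonneg hl0 hm0
  nlinarith

/-- The chord relaxation: `V ∈ [V₀, V₁] ⇒ V² ≤ (V₀+V₁)V − V₀V₁`. -/
theorem chord {V V₀ V₁ : ℝ} (h0 : V₀ ≤ V) (h1 : V ≤ V₁) : V ^ 2 ≤ (V₀ + V₁) * V - V₀ * V₁ := by
  have := mul_nonneg (sub_nonneg.2 h0) (sub_nonneg.2 h1)
  nlinarith

/-- The seven constraints are nonnegative at a region point of the box. -/
theorem constraints_nonneg {β z Vmin V₀ V₁ W₀ W₁ l lp V W VP : ℝ}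
    (hl0 : 0 ≤ l) (hl1 : β * l ≤ 1) (hm0 : 0 ≤ lp) (hm1 : β * lp ≤ 1)
    (hV0 : V₀ ≤ V) (hV1 : V ≤ V₁) (hW0 : W₀ ≤ W) (hW1 : W ≤ W₁)
    (hWd : β * ((2 * β - 1) * l - 1) ≤ (β - 1) * V) (hWd' : β * ((2 * β - 1) * lp - 1) ≤ (β - 1) * W)
    (hQ : |1 - (2 * β - 1) * l| ≤ V ^ 2) (hQ' : |1 - (2 * β - 1) * lp| ≤ W ^ 2)
    (hP : VP * (l + lp - (2 * β - 1) * l * lp) =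
      lp * (1 - β * l) * W + l * (1 - β * lp) * V + z * l * lp * V * W) (hVP : Vmin ≤ VP) :
    0 ≤ gP β z Vmin l lp V W ∧ 0 ≤ gQm β V₀ V₁ l V ∧ 0 ≤ gQp β V₀ V₁ l V ∧ 0 ≤ gQm β W₀ W₁ lp W ∧
      0 ≤ gQp β W₀ W₁ lp W ∧ 0 ≤ gW β l V ∧ 0 ≤ gW β lp W := by
  have hΛ := lamP_nonneg hl0 hl1 hm0 hm1
  have cV := chord hV0 hV1
  have cW := chord hW0 hW1
  have q1 := le_abs_self (1 - (2 * β - 1) * l)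
  have q2 := neg_abs_le (1 - (2 * β - 1) * l)
  have q3 := le_abs_self (1 - (2 * β - 1) * lp)
  have q4 := neg_abs_le (1 - (2 * β - 1) * lp)
  refine ⟨?_, ?_, ?_, ?_, ?_, ?_, ?_⟩
  · have : Vmin * (l + lp - (2 * β - 1) * l * lp) ≤ VP * (l + lp - (2 * β - 1) * l * lp) :=
      mul_le_mul_of_nonneg_right hVP hΛ
    simp only [gP]; linarith
  · simp only [gQm]; linarith
  · simp only [gQp]; linarith
  · simp only [gQm]; linarith
  · simp only [gQp]; linarith
  · simp only [gW]; linarith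
  · simp only [gW]; linarith

/-! ## The endpoint inequality from sixteen vertex values, with multipliers -/

/-- `cellExpr − Σ μᵢ Gᵢ` (S-procedure form of the endpoint expression). -/
def cellExprM (β z ε Vmin ca cb V₀ V₁ W₀ W₁ μ₁ μ₂ μ₃ μ₄ μ₅ μ₆ μ₇ : ℝ) (l lp V W : ℝ) : ℝ :=
  cellExpr β z ε ca cb l lp V W - μ₁ * gP β z Vmin l lp V W - μ₂ * gQm β V₀ V₁ l V - μ₃ * gQp β V₀ V₁ l V -
    μ₄ * gQm β W₀ W₁ lp W - μ₅ * gQp β W₀ W₁ lp W - μ₆ * gW β l V - μ₇ * gW β lp W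

/-- `cellExprM` is affine in each of the four cell variables. -/
theorem cellExprM_affine (β z ε Vmin ca cb V₀ V₁ W₀ W₁ μ₁ μ₂ μ₃ μ₄ μ₅ μ₆ μ₇ : ℝ) :
    (∀ b c d, ∃ p q : ℝ, ∀ t, cellExprM β z ε Vmin ca cb V₀ V₁ W₀ W₁ μ₁ μ₂ μ₃ μ₄ μ₅ μ₆ μ₇ t b c d = p + q * t) ∧
    (∀ a c d, ∃ p q : ℝ, ∀ t, cellExprM β z ε Vmin ca cb V₀ V₁ W₀ W₁ μ₁ μ₂ μ₃ μ₄ μ₅ μ₆ μ₇ a t c d = p + q * t) ∧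
    (∀ a b d, ∃ p q : ℝ, ∀ t, cellExprM β z ε Vmin ca cb V₀ V₁ W₀ W₁ μ₁ μ₂ μ₃ μ₄ μ₅ μ₆ μ₇ a b t d = p + q * t) ∧
    (∀ a b c, ∃ p q : ℝ, ∀ t, cellExprM β z ε Vmin ca cb V₀ V₁ W₀ W₁ μ₁ μ₂ μ₃ μ₄ μ₅ μ₆ μ₇ a b c t = p + q * t) := by
  refine ⟨fun b c d => affine_witness fun t => ?_, fun a c d => affine_witness fun t => ?_,
    fun a b d => affine_witness fun t => ?_, fun a b c => affine_witness fun t => ?_⟩ <;>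
  simp only [cellExprM, cellExpr, gP, gQm, gQp, gW] <;> ring

/-- **Endpoint inequality from the vertices (with multipliers).**  If `cellExprM ≥ 0` at the 16 vertices of the box
and `μᵢ ≥ 0`, then at every region point of the box `A·ca + B·cb ≤ Λ_P·(ε+1−V_P)`. -/
theorem cellM {β z ε Vmin ca cb l₀ l₁ V₀ V₁ m₀ m₁ W₀ W₁ μ₁ μ₂ μ₃ μ₄ μ₅ μ₆ μ₇ : ℝ}
    (hμ₁ : 0 ≤ μ₁) (hμ₂ : 0 ≤ μ₂) (hμ₃ : 0 ≤ μ₃) (hμ₄ : 0 ≤ μ₄) (hμ₅ : 0 ≤ μ₅) (hμ₆ : 0 ≤ μ₆) (hμ₇ : 0 ≤ μ₇)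
    (hv : ∀ a b c d : ℝ, (a = l₀ ∨ a = l₁) → (b = m₀ ∨ b = m₁) → (c = V₀ ∨ c = V₁) → (d = W₀ ∨ d = W₁) →
      0 ≤ cellExprM β z ε Vmin ca cb V₀ V₁ W₀ W₁ μ₁ μ₂ μ₃ μ₄ μ₅ μ₆ μ₇ a b c d)
    {lam lam' V V' VP : ℝ} (a1 : l₀ ≤ lam) (a2 : lam ≤ l₁) (a3 : V₀ ≤ V) (a4 : V ≤ V₁) (a5 : m₀ ≤ lam')
    (a6 : lam' ≤ m₁) (a7 : W₀ ≤ V') (a8 : V' ≤ W₁) (b1 : 0 ≤ lam) (b2 : β * lam ≤ 1) (b3 : 0 ≤ lam')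
    (b4 : β * lam' ≤ 1) (c1 : β * ((2 * β - 1) * lam - 1) ≤ (β - 1) * V)
    (c2 : β * ((2 * β - 1) * lam' - 1) ≤ (β - 1) * V') (c3 : |1 - (2 * β - 1) * lam| ≤ V ^ 2)
    (c4 : |1 - (2 * β - 1) * lam'| ≤ V' ^ 2)
    (hP : VP * (lam + lam' - (2 * β - 1) * lam * lam') =
      lam' * (1 - β * lam) * V' + lam * (1 - β * lam') * V + z * lam * lam' * V * V') (hVP : Vmin ≤ VP) :
    (1 - (β - 1) * lam') * (lam * (ε + 1 - V)) * ca + (1 - (β - 1) * lam) * (lam' * (ε + 1 - V')) * cb ≤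
      (lam + lam' - (2 * β - 1) * lam * lam') * (ε + 1 - VP) := by
  obtain ⟨h1, h2, h3, h4⟩ := cellExprM_affine β z ε Vmin ca cb V₀ V₁ W₀ W₁ μ₁ μ₂ μ₃ μ₄ μ₅ μ₆ μ₇
  have key := box4 h1 h2 h3 h4
    (hv _ _ _ _ (Or.inl rfl) (Or.inl rfl) (Or.inl rfl) (Or.inl rfl))
    (hv _ _ _ _ (Or.inl rfl) (Or.inr rfl) (Or.inl rfl) (Or.inl rfl))
    (hv _ _ _ _ (Or.inr rfl) (Or.inl rfl) (Or.inl rfl) (Or.inl rfl))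
    (hv _ _ _ _ (Or.inr rfl) (Or.inr rfl) (Or.inl rfl) (Or.inl rfl))
    (hv _ _ _ _ (Or.inl rfl) (Or.inl rfl) (Or.inr rfl) (Or.inl rfl))
    (hv _ _ _ _ (Or.inl rfl) (Or.inr rfl) (Or.inr rfl) (Or.inl rfl))
    (hv _ _ _ _ (Or.inr rfl) (Or.inl rfl) (Or.inr rfl) (Or.inl rfl))
    (hv _ _ _ _ (Or.inr rfl) (Or.inr rfl) (Or.inr rfl) (Or.inl rfl))
    (hv _ _ _ _ (Or.inl rfl) (Or.inl rfl) (Or.inl rfl) (Or.inr rfl))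
    (hv _ _ _ _ (Or.inl rfl) (Or.inr rfl) (Or.inl rfl) (Or.inr rfl))
    (hv _ _ _ _ (Or.inr rfl) (Or.inl rfl) (Or.inl rfl) (Or.inr rfl))
    (hv _ _ _ _ (Or.inr rfl) (Or.inr rfl) (Or.inl rfl) (Or.inr rfl))
    (hv _ _ _ _ (Or.inl rfl) (Or.inl rfl) (Or.inr rfl) (Or.inr rfl))
    (hv _ _ _ _ (Or.inl rfl) (Or.inr rfl) (Or.inr rfl) (Or.inr rfl))
    (hv _ _ _ _ (Or.inr rfl) (Or.inl rfl) (Or.inr rfl) (Or.inr rfl))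
    (hv _ _ _ _ (Or.inr rfl) (Or.inr rfl) (Or.inr rfl) (Or.inr rfl))
    lam lam' V V' a1 a2 a5 a6 a3 a4 a7 a8
  obtain ⟨g1, g2, g3, g4, g5, g6, g7⟩ :=
    constraints_nonneg (z := z) (Vmin := Vmin) (V₀ := V₀) (V₁ := V₁) (W₀ := W₀) (W₁ := W₁)
      b1 b2 b3 b4 a3 a4 a7 a8 c1 c2 c3 c4 hP hVP
  have e : cellExprM β z ε Vmin ca cb V₀ V₁ W₀ W₁ μ₁ μ₂ μ₃ μ₄ μ₅ μ₆ μ₇ lam lam' V V' =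
      (lam + lam' - (2 * β - 1) * lam * lam') * (ε + 1 - VP) -
        ((1 - (β - 1) * lam') * (lam * (ε + 1 - V)) * ca + (1 - (β - 1) * lam) * (lam' * (ε + 1 - V')) * cb) -
        (μ₁ * gP β z Vmin lam lam' V V' + μ₂ * gQm β V₀ V₁ lam V + μ₃ * gQp β V₀ V₁ lam V +
          μ₄ * gQm β W₀ W₁ lam' V' + μ₅ * gQp β W₀ W₁ lam' V' + μ₆ * gW β lam V + μ₇ * gW β lam' V') := by
    simp only [cellExprM, cellExpr]; linear_combination hP
  have m1 := mul_nonneg hμ₁ g1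
  have m2 := mul_nonneg hμ₂ g2
  have m3 := mul_nonneg hμ₃ g3
  have m4 := mul_nonneg hμ₄ g4
  have m5 := mul_nonneg hμ₅ g5
  have m6 := mul_nonneg hμ₆ g6
  have m7 := mul_nonneg hμ₇ g7
  linarith [key, e]

/-! ## Tangent majorants with a rational exponent bound -/

/-- **Right-endpoint tangent.**  For `0 ≤ x ≤ x₀`, `0 < x₀`, `κ' ≤ κ ≤ 1`, `0 ≤ κ'` and a height `x₀^κ ≤ ρ`:
`x^κ ≤ ρ·(1 + κ'·(x/x₀ − 1))` (the tangent at `x₀` is antitone in the exponent to the left of `x₀`). -/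
theorem tangent_right {x x₀ κ κ' ρ : ℝ} (hx : 0 ≤ x) (hxx : x ≤ x₀) (hx0 : 0 < x₀) (hκ' : κ' ≤ κ)
    (hκ'0 : 0 ≤ κ') (hκ1 : κ ≤ 1) (hρ : x₀ ^ κ ≤ ρ) : x ^ κ ≤ ρ * (1 + κ' * (x / x₀ - 1)) := by
  have hκ0 : 0 ≤ κ := hκ'0.trans hκ'
  have h := FarEdgeDescentCriterionCells.tangent_height hx hx0 hκ0 hκ1 le_rfl (ρ := x₀ ^ κ) (x := x)
  -- h : x^κ ≤ (1−κ) x₀^κ + κ (x₀^κ/x₀) x = x₀^κ (1 + κ (x/x₀ − 1))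
  have hp : 0 ≤ x₀ ^ κ := Real.rpow_nonneg hx0.le κ
  have hr : x / x₀ - 1 ≤ 0 := by rw [sub_nonpos, div_le_one hx0]; exact hxx
  have e1 : (1 - κ) * x₀ ^ κ + κ * (x₀ ^ κ / x₀) * x = x₀ ^ κ * (1 + κ * (x / x₀ - 1)) := by
    field_simp; ring
  rw [e1] at h
  have h2 : κ * (x / x₀ - 1) ≤ κ' * (x / x₀ - 1) := by nlinarith
  have h3 : x₀ ^ κ * (1 + κ * (x / x₀ - 1)) ≤ x₀ ^ κ * (1 + κ' * (x / x₀ - 1)) :=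
    mul_le_mul_of_nonneg_left (by linarith) hp
  have hf : 0 ≤ 1 + κ' * (x / x₀ - 1) := by
    have : 0 ≤ x / x₀ := div_nonneg hx hx0.le
    nlinarith
  have h4 : x₀ ^ κ * (1 + κ' * (x / x₀ - 1)) ≤ ρ * (1 + κ' * (x / x₀ - 1)) :=
    mul_le_mul_of_nonneg_right hρ hf
  linarith

/-- **Leaf cell from data.**  Heights `x₂^κ ≤ ρ`, `(1−x₁)^κ ≤ σ`, rounded tangent coefficients
`ρ(1 + 17/41·(x₁/x₂ − 1)) ≤ ca₁`, `σ ≤ cb₁` (at `x = x₁`) and `ρ ≤ ca₂`, `σ(1 + 17/41·((1−x₂)/(1−x₁) − 1)) ≤ cb₂`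
(at `x = x₂`), and the two endpoint inequalities from `cellM` ⊢ the cell claim on `box × [x₁, x₂]`
(`17/41 ≤ κ ≤ 1`, `0 ≤ x₁ < x₂ ≤ 1`, `0 ≤ ε`). -/
theorem leafCell {β z ε Vmin κ l₀ l₁ V₀ V₁ m₀ m₁ W₀ W₁ x₁ x₂ ρ σ ca₁ cb₁ ca₂ cb₂ : ℝ}
    {μ₁ μ₂ μ₃ μ₄ μ₅ μ₆ μ₇ ν₁ ν₂ ν₃ ν₄ ν₅ ν₆ ν₇ : ℝ}
    (hε : 0 ≤ ε) (hκ : 17 / 41 ≤ κ) (hκ1 : κ ≤ 1)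
    (hx₁ : 0 ≤ x₁) (hx12 : x₁ < x₂) (hx₂ : x₂ ≤ 1) (hρ : x₂ ^ κ ≤ ρ) (hσ : (1 - x₁) ^ κ ≤ σ)
    (hca₁ : ρ * (1 + 17 / 41 * (x₁ / x₂ - 1)) ≤ ca₁) (hcb₁ : σ ≤ cb₁) (hca₂ : ρ ≤ ca₂)
    (hcb₂ : σ * (1 + 17 / 41 * ((1 - x₂) / (1 - x₁) - 1)) ≤ cb₂)
    (hμ : 0 ≤ μ₁ ∧ 0 ≤ μ₂ ∧ 0 ≤ μ₃ ∧ 0 ≤ μ₄ ∧ 0 ≤ μ₅ ∧ 0 ≤ μ₆ ∧ 0 ≤ μ₇)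
    (hν : 0 ≤ ν₁ ∧ 0 ≤ ν₂ ∧ 0 ≤ ν₃ ∧ 0 ≤ ν₄ ∧ 0 ≤ ν₅ ∧ 0 ≤ ν₆ ∧ 0 ≤ ν₇)
    (hv₁ : ∀ a b c d : ℝ, (a = l₀ ∨ a = l₁) → (b = m₀ ∨ b = m₁) → (c = V₀ ∨ c = V₁) → (d = W₀ ∨ d = W₁) →
      0 ≤ cellExprM β z ε Vmin ca₁ cb₁ V₀ V₁ W₀ W₁ μ₁ μ₂ μ₃ μ₄ μ₅ μ₆ μ₇ a b c d)
    (hv₂ : ∀ a b c d : ℝ, (a = l₀ ∨ a = l₁) → (b = m₀ ∨ b = m₁) → (c = V₀ ∨ c = V₁) → (d = W₀ ∨ d = W₁) →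
      0 ≤ cellExprM β z ε Vmin ca₂ cb₂ V₀ V₁ W₀ W₁ ν₁ ν₂ ν₃ ν₄ ν₅ ν₆ ν₇ a b c d) :
    CellClaim β z ε Vmin κ l₀ l₁ V₀ V₁ m₀ m₁ W₀ W₁ x₁ x₂ := by
  intro lam lam' V V' VP x a1 a2 a3 a4 a5 a6 a7 a8 b1 b2 b3 b4 b5 b6 b7 b8 c1 c2 c3 c4 hP hVP hx1 hx2 hx0 hx1'
  obtain ⟨hμ₁, hμ₂, hμ₃, hμ₄, hμ₅, hμ₆, hμ₇⟩ := hμ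
  obtain ⟨hν₁, hν₂, hν₃, hν₄, hν₅, hν₆, hν₇⟩ := hν
  have E1 := cellM hμ₁ hμ₂ hμ₃ hμ₄ hμ₅ hμ₆ hμ₇ hv₁ a1 a2 a3 a4 a5 a6 a7 a8 b1 b2 b3 b4 c1 c2 c3 c4 hP hVP
  have E2 := cellM hν₁ hν₂ hν₃ hν₄ hν₅ hν₆ hν₇ hv₂ a1 a2 a3 a4 a5 a6 a7 a8 b1 b2 b3 b4 c1 c2 c3 c4 hP hVP
  -- names
  set A := (1 - (β - 1) * lam') * (lam * (ε + 1 - V)) with hA_def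
  set B := (1 - (β - 1) * lam) * (lam' * (ε + 1 - V')) with hB_def
  set R := (lam + lam' - (2 * β - 1) * lam * lam') * (ε + 1 - VP) with hR_def
  have hA : 0 ≤ A := by
    have : (β - 1) * lam' ≤ β * lam' := mul_le_mul_of_nonneg_right (by linarith) b3
    exact mul_nonneg (by linarith) (mul_nonneg b1 (by linarith))
  have hB : 0 ≤ B := by
    have : (β - 1) * lam ≤ β * lam := mul_le_mul_of_nonneg_right (by linarith) b1
    exact mul_nonneg (by linarith) (mul_nonneg b3 (by linarith))
  have hx2pos : 0 < x₂ := lt_of_le_of_lt hx₁ hx12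
  have h1x1 : 0 < 1 - x₁ := by linarith
  have hκ0 : (0:ℝ) ≤ 17 / 41 := by norm_num
  -- tangent majorants on the cell
  have T1 : x ^ κ ≤ ρ * (1 + 17 / 41 * (x / x₂ - 1)) := tangent_right hx0 hx2 hx2pos hκ hκ0 hκ1 hρ
  have T2 : (1 - x) ^ κ ≤ σ * (1 + 17 / 41 * ((1 - x) / (1 - x₁) - 1)) :=
    tangent_right (by linarith) (by linarith) h1x1 hκ hκ0 hκ1 hσ
  have hρ0 : 0 ≤ ρ := (Real.rpow_nonneg hx2pos.le κ).trans hρ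
  have hσ0 : 0 ≤ σ := (Real.rpow_nonneg h1x1.le κ).trans hσ
  -- the affine majorant p + q·x and its values at the endpoints
  have M : A * x ^ κ + B * (1 - x) ^ κ ≤
      A * (ρ * (1 + 17 / 41 * (x / x₂ - 1))) + B * (σ * (1 + 17 / 41 * ((1 - x) / (1 - x₁) - 1))) := by
    have := mul_le_mul_of_nonneg_left T1 hA
    have := mul_le_mul_of_nonneg_left T2 hB
    linarith
  -- endpoint values are below (ca₁, cb₁) resp. (ca₂, cb₂)
  have P1 : A * (ρ * (1 + 17 / 41 * (x₁ / x₂ - 1))) + B * (σ * (1 + 17 / 41 * ((1 - x₁) / (1 - x₁) - 1))) ≤ R := by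
    have e : (1 - x₁) / (1 - x₁) = 1 := div_self h1x1.ne'
    rw [e]
    have u1 := mul_le_mul_of_nonneg_left hca₁ hA
    have u2 : B * (σ * (1 + 17 / 41 * (1 - 1))) ≤ B * cb₁ := by
      have : σ * (1 + 17 / 41 * (1 - 1)) = σ := by ring
      rw [this]; exact mul_le_mul_of_nonneg_left hcb₁ hB
    linarith [E1]
  have P2 : A * (ρ * (1 + 17 / 41 * (x₂ / x₂ - 1))) + B * (σ * (1 + 17 / 41 * ((1 - x₂) / (1 - x₁) - 1))) ≤ R := by
    have e : x₂ / x₂ = 1 := div_self hx2pos.ne'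
    rw [e]
    have u1 : A * (ρ * (1 + 17 / 41 * (1 - 1))) ≤ A * ca₂ := by
      have : ρ * (1 + 17 / 41 * (1 - 1)) = ρ := by ring
      rw [this]; exact mul_le_mul_of_nonneg_left hca₂ hA
    have u2 := mul_le_mul_of_nonneg_left hcb₂ hB
    linarith [E2]
  -- the majorant is affine in x: write it as p + q x and interpolate
  have e : ∀ t : ℝ, A * (ρ * (1 + 17 / 41 * (t / x₂ - 1))) + B * (σ * (1 + 17 / 41 * ((1 - t) / (1 - x₁) - 1))) =
      (A * ρ * (1 - 17 / 41) + B * σ * (1 + 17 / 41 * (1 / (1 - x₁) - 1))) +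
        (A * ρ * (17 / 41) / x₂ - B * σ * (17 / 41) / (1 - x₁)) * t := by
    intro t; field_simp; ring
  rw [e] at M P1 P2
  exact M.trans (FarEdgeDescentCriterionCells.lin_cell P1 P2 hx1 hx2)

end Summit.MatrixMultiplication.MatrixMultiplication.Theorems.FarEdgeDescentCertTools
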